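import Literature.NumberTheory.Automorphic.U21RootMonomials     -- ★ `u21E`, `u21F`, `u21e`, `u21f`, `u21h` and the bracket table of `𝔨_ℂ` against `𝔭^±`
import HarnessLib

/-!
# K2 ∕ E1b · 8b-αᵤ road FILE 3 «𝔭-ACTION NORMAL FORM» (O6 of the 8b-α census): Kovačević's Theorem 1 for an abstract `(𝔤, K)`-module of `U(2,1)`

HCML Track B «K2-LIT», cell `hodgecm-mathlib`, crux H413 = stmt-HodgeConjecture-24833 (supports-only helper; closes nothing by itself).  Socket 8b-αᵤ
`sig_K2E1bModelOfRecordCohUnitary` (U8d ED. 5), census `K2/K2-defs1/g3/CENSUS-8b-alpha-ModelOfRecord.K2-defs1-g3.md` row **O6** («the one genuinely new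
computation»); DEAL K2E1b-plan (g4) → K2E4-p10 (g3) 2026-09-04T04:05:48Z.  THEOREMS ONLY over ★ `U21RootMonomials` (no `def`, no `sorry`, no instance
declaration, no notation); INDEPENDENT of files 1∕2a∕2b (their currency enters only through the SHAPE of the hypotheses: torus weights
`ρ_ℂ(E_jj) v = w_j v` = file 1's `mem_wtSpace_iff`, strings `u^{k+1} = (−f)^k u¹` = file 2a's normalisation, «a primitive vector of torus weight `w′` is a
multiple of the chosen one» = file 2b's multiplicity one).

## The statement (Kovačević [§3 Thm. 1], `u`-normalisation of ★ `SU21ModulesFromKTypes`)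

Let `ρ𝔤` be `(𝔤, K)`-module data of `U(2,1)` on `V`; `T_j = ρ_ℂ(E_jj)` (`j ∈ Fin 2 ⊕ Fin 1`), `e = ρ_ℂ(E₀₁)`, `f = ρ_ℂ(E₁₀)`, `E_j = ρ_ℂ(E_{j2})` (`𝔭⁺`),
`F_j = ρ_ℂ(E_{2j})` (`𝔭⁻`).  Let `v` be PRIMITIVE (`e v = 0`) of torus weight `w` with `n = w₀ − w₁ + 1 ≥ 1` (its K-type is `V_{n,m}`, `u^{k+1} := (−f)^k v`).
**`𝔭⁺` (`pPlus_normalForm`)**: if `v₊` is primitive of weight `w + δ₀ − δ₂` (type `(n+1, m+3)`) and EVERY primitive vector of that weight is a multiple of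
`v₊`, and every primitive vector of weight `w + δ₁ − δ₂` (type `(n−1, m+3)`) is a multiple of `v₋`, then there are `A, C ∈ ℂ` with, for all `k`,
`E₀ u^{k+1} = (n−k)·A·u₊^{k+1} + k·C·u₋^{k}` and `E₁ u^{k+1} = −A·u₊^{k+2} + C·u₋^{k+1}`
— i.e. `X_{α+β} u^k = (n+1−k)A u^k_{n+1,m+3} + (k−1)C u^{k−1}_{n−1,m+3}`, `X_β u^k = −A u^{k+1}_{n+1,m+3} + C u^k_{n−1,m+3}` (★ `Xab_vec`, ★ `Xb_vec`).
**`𝔭⁻` (`pMinus_normalForm`)**: symmetrically with weights `w + δ₂ − δ₁` (type `(n+1, m−3)`), `w + δ₂ − δ₀` (type `(n−1, m−3)`):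
`F₁ u^{k+1} = (n−k)·B·u′₊^{k+1} − k·D·u′₋^{k}`, `F₀ u^{k+1} = B·u′₊^{k+2} + D·u′₋^{k+1}` (★ `Yb_vec`, ★ `Yab_vec`).

## The proof ([Kovacevic2021, proof of Thm. 1, p0005–p0006], by the bracket table ★ `U21RootMonomials` §1)

`k = 0`: `e(E₀v) = E₀(e v) = 0` and `E₀v` has weight `w + δ₀ − δ₂`, so `E₀ v = a·v₊`, `A := a∕n`; `y := E₁ v + A·(−f)v₊` is primitive (`e E₁ = E₁ e + E₀`,
`e f = f e + h`, `h v₊ = n v₊`) of weight `w + δ₁ − δ₂`, so `y = C·v₋`.  `k → k+1`: `u^{k+2} = −f u^{k+1}` and `f E₁ = E₁ f`, `E₀ f = f E₀ − E₁`.  The `𝔭⁻` half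
is the same with `e F₁ = F₁ e`, `e F₀ = F₀ e − F₁`, `f F₀ = F₀ f`, `F₁ f = f F₁ + F₀`.  (§0: the torus-weight shifts `[T_i, ρ_ℂ(E_{ab})] = (δ_{ia} − δ_{ib})ρ_ℂ(E_{ab})`
and the matrix-unit spelling of `E_j, F_j, e, f, h`.)

HONEST LABEL: a helper of the 8b-αᵤ road (file 3 of 5); it closes nothing by itself; HC_CM is proved only modulo the 7 printed citations (2 remaining named
inputs: hLiu418 = stmt-HodgeConjecture-24832, h413 = stmt-HodgeConjecture-24833) until rung 0 closes.
-/

-- Mathlib idiom (as in ★ `U21RootMonomials` and every `(𝔤, K)` file of the tree): the commutator bracket on `Module.End ℂ V` and on matrices,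
-- needed to MENTION `ρ𝔤 : (uFormGroup (Fin 2) (Fin 1)).lie →ₗ⁅ℝ⁆ Module.End ℂ V`.
attribute [local instance 100] LieRing.ofAssociativeRing

set_option autoImplicit false
set_option linter.dupNamespace false

noncomputable section

namespace Summit.HodgeConjecture.HodgeConjecture.Cruxes.H413.K2E1bU21PActionNormalForm

open Literature.RepresentationTheory Literature.RepresentationTheory.KonnoKonno2007
open Literature.NumberTheory.Automorphic

variable {V : Type*} [AddCommGroup V] [Module ℂ V] (ρ𝔤 : (uFormGroup (Fin 2) (Fin 1)).lie →ₗ⁅ℝ⁆ Module.End ℂ V)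

/-! ## §0 Matrix-unit spelling of the root operators, and torus-weight shifts -/

/-- `E_j = ρ_ℂ(E_{j,2})` as a matrix unit of `𝔤𝔩(Fin 2 ⊕ Fin 1)`. [cite: BorelWallach2000, II §4.1] -/
theorem u21E_eq_upqLieC_single (j : Fin 2) : u21E ρ𝔤 j = upqLieC ρ𝔤 (Matrix.single (Sum.inl j) (Sum.inr 0) (1 : ℂ)) := by
  rw [u21E_def, upqEOp_apply]
  congr 1
  ext (a | a) (b | b)
  · simp
  · fin_cases b; by_cases h : j = a <;> simp [h]
  · simp
  · simp

/-- `F_j = ρ_ℂ(E_{2,j})` as a matrix unit. [cite: BorelWallach2000, II §4.1] -/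
theorem u21F_eq_upqLieC_single (j : Fin 2) : u21F ρ𝔤 j = upqLieC ρ𝔤 (Matrix.single (Sum.inr 0) (Sum.inl j) (1 : ℂ)) := by
  rw [u21F_def, upqFOp_apply]
  congr 1
  ext (a | a) (b | b)
  · simp
  · simp
  · fin_cases a; by_cases h : j = b <;> simp [h]
  · simp

/-- `e = ρ_ℂ(E₀₁)` as a matrix unit. [cite: KnappVogan1995, §IV.1] -/
theorem u21e_eq_upqLieC_single : u21e ρ𝔤 = upqLieC ρ𝔤 (Matrix.single (Sum.inl 0) (Sum.inl 1) (1 : ℂ)) := by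
  rw [u21e]
  congr 1
  ext (a | a) (b | b)
  · fin_cases a <;> fin_cases b <;> simp
  · simp
  · simp
  · simp

/-- `f = ρ_ℂ(E₁₀)` as a matrix unit. [cite: KnappVogan1995, §IV.1] -/
theorem u21f_eq_upqLieC_single : u21f ρ𝔤 = upqLieC ρ𝔤 (Matrix.single (Sum.inl 1) (Sum.inl 0) (1 : ℂ)) := by
  rw [u21f]
  congr 1
  ext (a | a) (b | b)
  · fin_cases a <;> fin_cases b <;> simp
  · simp
  · simp
  · simp

/-- `h = T₀ − T₁` with `T_j = ρ_ℂ(E_jj)`. [cite: KnappVogan1995, §IV.1] -/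
theorem u21h_eq_sub : u21h ρ𝔤 =
    upqLieC ρ𝔤 (Matrix.single (Sum.inl 0) (Sum.inl 0) (1 : ℂ)) - upqLieC ρ𝔤 (Matrix.single (Sum.inl 1) (Sum.inl 1) (1 : ℂ)) := by
  rw [u21h, ← map_sub]
  congr 1
  ext (a | a) (b | b)
  · fin_cases a <;> fin_cases b <;> simp
  · simp
  · simp
  · simp

/-- **Torus-weight shift**: `[T_i, ρ_ℂ(E_{ab})] = (δ_{ia} − δ_{ib}) ρ_ℂ(E_{ab})`, so a vector of torus weight `w` is sent by `ρ_ℂ(E_{ab})` to one of weight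
`w + δ_a − δ_b`. [cite: Kovacevic2021, §3 Thm 1] [cite: KnappVogan1995, Prop. 1.18] -/
theorem weight_upqLieC_single {w : Fin 2 ⊕ Fin 1 → ℤ} {y : V}
    (hy : ∀ i, upqLieC ρ𝔤 (Matrix.single i i (1 : ℂ)) y = (w i : ℂ) • y) (a b i : Fin 2 ⊕ Fin 1) :
    upqLieC ρ𝔤 (Matrix.single i i (1 : ℂ)) (upqLieC ρ𝔤 (Matrix.single a b (1 : ℂ)) y) =
      ((w + Pi.single a 1 - Pi.single b 1 : Fin 2 ⊕ Fin 1 → ℤ) i : ℂ) • upqLieC ρ𝔤 (Matrix.single a b (1 : ℂ)) y := by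
  have hcomm := upqLieC_mul_sub_mul ρ𝔤 (Matrix.single i i (1 : ℂ)) (Matrix.single a b (1 : ℂ))
  have hmat : Matrix.single i i (1 : ℂ) * Matrix.single a b 1 - Matrix.single a b 1 * Matrix.single i i 1 =
      ((if i = a then 1 else 0) - (if i = b then 1 else 0) : ℂ) • Matrix.single a b 1 := by
    by_cases hia : i = a <;> by_cases hib : i = b
    · subst hia; subst hib; simp
    · subst hia; simp [Ne.symm hib, hib]
    · subst hib; simp [hia]
    · simp [hia, hib, Ne.symm hib]
  rw [hmat, map_smul] at hcomm
  have happ := LinearMap.congr_fun hcomm y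
  rw [LinearMap.sub_apply, Module.End.mul_apply, Module.End.mul_apply, LinearMap.smul_apply, hy i] at happ
  rw [map_smul] at happ
  have key : upqLieC ρ𝔤 (Matrix.single i i 1) (upqLieC ρ𝔤 (Matrix.single a b 1) y) =
      ((w i : ℂ) + ((if i = a then 1 else 0) - (if i = b then 1 else 0))) • upqLieC ρ𝔤 (Matrix.single a b 1) y := by
    rw [add_smul, happ]; abel
  rw [key]
  congr 1
  simp only [Pi.add_apply, Pi.sub_apply, Pi.single_apply, Int.cast_add, Int.cast_sub, Int.cast_ite, Int.cast_one, Int.cast_zero]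
  ring

/-! ## §1 The `𝔭⁺`-action in normal form -/

/-- **KOVAČEVIĆ'S THEOREM 1, `𝔭⁺` HALF.**  See the module docstring: for a primitive `v` of torus weight `w` (`n = w₀ − w₁ + 1 ≥ 1`), a primitive `v₊` of
weight `w + δ₀ − δ₂` through which every primitive vector of that weight factors, and `v₋` through which every primitive vector of weight `w + δ₁ − δ₂`
factors, there are `A, C` with `E₀ u^{k+1} = (n−k)A u₊^{k+1} + kC u₋^{k}`, `E₁ u^{k+1} = −A u₊^{k+2} + C u₋^{k+1}` (`u^{k+1} = (−f)^k u¹`).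
[cite: Kovacevic2021, §3 Thm 1] [cite: BorelWallach2000, II §4.1] -/
theorem pPlus_normalForm {w : Fin 2 ⊕ Fin 1 → ℤ} {n : ℕ} (hn : (n : ℤ) = w (Sum.inl 0) - w (Sum.inl 1) + 1) (hn1 : 1 ≤ n)
    {v vp vm : V} (hv : ∀ i, upqLieC ρ𝔤 (Matrix.single i i (1 : ℂ)) v = (w i : ℂ) • v) (hev : u21e ρ𝔤 v = 0)
    (hvp : ∀ i, upqLieC ρ𝔤 (Matrix.single i i (1 : ℂ)) vp = ((w + Pi.single (Sum.inl 0) 1 - Pi.single (Sum.inr 0) 1 : Fin 2 ⊕ Fin 1 → ℤ) i : ℂ) • vp)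
    (hevp : u21e ρ𝔤 vp = 0)
    (huniqp : ∀ y : V, (∀ i, upqLieC ρ𝔤 (Matrix.single i i (1 : ℂ)) y = ((w + Pi.single (Sum.inl 0) 1 - Pi.single (Sum.inr 0) 1 : Fin 2 ⊕ Fin 1 → ℤ) i : ℂ) • y) →
      u21e ρ𝔤 y = 0 → ∃ c : ℂ, y = c • vp)
    (huniqm : ∀ y : V, (∀ i, upqLieC ρ𝔤 (Matrix.single i i (1 : ℂ)) y = ((w + Pi.single (Sum.inl 1) 1 - Pi.single (Sum.inr 0) 1 : Fin 2 ⊕ Fin 1 → ℤ) i : ℂ) • y) →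
      u21e ρ𝔤 y = 0 → ∃ c : ℂ, y = c • vm) :
    ∃ A C : ℂ, ∀ k : ℕ,
      u21E ρ𝔤 0 (((-u21f ρ𝔤) ^ k) v) = (((n : ℂ) - k) * A) • ((-u21f ρ𝔤) ^ k) vp + ((k : ℂ) * C) • ((-u21f ρ𝔤) ^ (k - 1)) vm ∧
      u21E ρ𝔤 1 (((-u21f ρ𝔤) ^ k) v) = (-A) • ((-u21f ρ𝔤) ^ (k + 1)) vp + C • ((-u21f ρ𝔤) ^ k) vm := by
  -- abbreviations of the bracket table (★ `U21RootMonomials` §1), applied to vectors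
  have heE0 : ∀ x : V, u21e ρ𝔤 (u21E ρ𝔤 0 x) = u21E ρ𝔤 0 (u21e ρ𝔤 x) := fun x => by
    simpa only [Module.End.mul_apply] using LinearMap.congr_fun (u21e_mul_u21E_zero ρ𝔤) x
  have heE1 : ∀ x : V, u21e ρ𝔤 (u21E ρ𝔤 1 x) = u21E ρ𝔤 1 (u21e ρ𝔤 x) + u21E ρ𝔤 0 x := fun x => by
    simpa only [Module.End.mul_apply, LinearMap.add_apply] using LinearMap.congr_fun (u21e_mul_u21E_one ρ𝔤) x
  have hfE0 : ∀ x : V, u21E ρ𝔤 0 (u21f ρ𝔤 x) = u21f ρ𝔤 (u21E ρ𝔤 0 x) - u21E ρ𝔤 1 x := fun x => by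
    have := LinearMap.congr_fun (u21f_mul_u21E_zero ρ𝔤) x
    simp only [Module.End.mul_apply, LinearMap.add_apply] at this
    rw [this]; abel
  have hfE1 : ∀ x : V, u21E ρ𝔤 1 (u21f ρ𝔤 x) = u21f ρ𝔤 (u21E ρ𝔤 1 x) := fun x => by
    simpa only [Module.End.mul_apply] using (LinearMap.congr_fun (u21f_mul_u21E_one ρ𝔤) x).symm
  have hef : ∀ x : V, u21e ρ𝔤 (u21f ρ𝔤 x) = u21f ρ𝔤 (u21e ρ𝔤 x) + u21h ρ𝔤 x := fun x => by
    have := LinearMap.congr_fun (u21e_mul_u21f_sub ρ𝔤) x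
    simp only [Module.End.mul_apply, LinearMap.sub_apply] at this
    rw [← this]; abel
  have hF : ∀ (x : V) (j : ℕ), ((-u21f ρ𝔤) ^ (j + 1)) x = -(u21f ρ𝔤 (((-u21f ρ𝔤) ^ j) x)) := fun x j => by
    rw [pow_succ', Module.End.mul_apply, LinearMap.neg_apply]
  have hF' : ∀ (x : V) (j : ℕ), u21f ρ𝔤 (((-u21f ρ𝔤) ^ j) x) = -(((-u21f ρ𝔤) ^ (j + 1)) x) := fun x j => by
    rw [hF, neg_neg]
  -- `h vp = n vp`
  have hn0 : (n : ℂ) ≠ 0 := by exact_mod_cast (show n ≠ 0 by omega)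
  have hhvp : u21h ρ𝔤 vp = (n : ℂ) • vp := by
    rw [u21h_eq_sub, LinearMap.sub_apply, hvp, hvp, ← sub_smul]
    congr 1
    have : ((n : ℤ) : ℂ) = (n : ℂ) := by norm_cast
    rw [← this, hn]
    push_cast
    simp only [Pi.add_apply, Pi.sub_apply, Pi.single_apply]
    simp
    ring
  -- step 1: `E₀ v = a • vp`
  have hwE0 : ∀ i, upqLieC ρ𝔤 (Matrix.single i i (1 : ℂ)) (u21E ρ𝔤 0 v) =
      ((w + Pi.single (Sum.inl 0) 1 - Pi.single (Sum.inr 0) 1 : Fin 2 ⊕ Fin 1 → ℤ) i : ℂ) • u21E ρ𝔤 0 v := fun i => by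
    rw [u21E_eq_upqLieC_single]; exact weight_upqLieC_single ρ𝔤 hv _ _ i
  obtain ⟨a, ha⟩ := huniqp _ hwE0 (by rw [heE0, hev, map_zero])
  set A : ℂ := a / n with hAdef
  have hA : (n : ℂ) * A = a := by rw [hAdef]; field_simp
  -- step 2: `y = E₁ v + A • (−f) vp` is primitive of weight `w + δ₁ − δ₂`
  have hwE1 : ∀ i, upqLieC ρ𝔤 (Matrix.single i i (1 : ℂ)) (u21E ρ𝔤 1 v) =
      ((w + Pi.single (Sum.inl 1) 1 - Pi.single (Sum.inr 0) 1 : Fin 2 ⊕ Fin 1 → ℤ) i : ℂ) • u21E ρ𝔤 1 v := fun i => by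
    rw [u21E_eq_upqLieC_single]; exact weight_upqLieC_single ρ𝔤 hv _ _ i
  have hwfvp : ∀ i, upqLieC ρ𝔤 (Matrix.single i i (1 : ℂ)) (u21f ρ𝔤 vp) =
      ((w + Pi.single (Sum.inl 1) 1 - Pi.single (Sum.inr 0) 1 : Fin 2 ⊕ Fin 1 → ℤ) i : ℂ) • u21f ρ𝔤 vp := fun i => by
    rw [u21f_eq_upqLieC_single, weight_upqLieC_single ρ𝔤 hvp _ _ i]
    congr 1
    simp only [Pi.add_apply, Pi.sub_apply, Pi.single_apply, Int.cast_add, Int.cast_sub, Int.cast_ite, Int.cast_one, Int.cast_zero]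
    split_ifs <;> ring
  have hwy : ∀ i, upqLieC ρ𝔤 (Matrix.single i i (1 : ℂ)) (u21E ρ𝔤 1 v + A • ((-u21f ρ𝔤) vp)) =
      ((w + Pi.single (Sum.inl 1) 1 - Pi.single (Sum.inr 0) 1 : Fin 2 ⊕ Fin 1 → ℤ) i : ℂ) •
        (u21E ρ𝔤 1 v + A • ((-u21f ρ𝔤) vp)) := fun i => by
    rw [LinearMap.neg_apply, map_add, map_smul, map_neg, hwE1, hwfvp]
    module
  have hey : u21e ρ𝔤 (u21E ρ𝔤 1 v + A • ((-u21f ρ𝔤) vp)) = 0 := by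
    rw [LinearMap.neg_apply, map_add, map_smul, map_neg, heE1, hev, map_zero, zero_add, ha, hef, hevp, map_zero,
      zero_add, hhvp, smul_neg, smul_smul, mul_comm A, hA, add_neg_cancel]
  obtain ⟨C, hC⟩ := huniqm _ hwy hey
  have hE1v : u21E ρ𝔤 1 v = (-A) • ((-u21f ρ𝔤) ^ (0 + 1)) vp + C • ((-u21f ρ𝔤) ^ 0) vm := by
    rw [zero_add, pow_one, pow_zero, Module.End.one_apply, ← hC, neg_smul]; abel
  -- step 3: induction on `k`
  refine ⟨A, C, fun k => ?_⟩
  induction k with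
  | zero =>
    refine ⟨?_, hE1v⟩
    rw [pow_zero, Module.End.one_apply, ha, ← hA]
    simp
  | succ k ih =>
    obtain ⟨ih0, ih1⟩ := ih
    constructor
    · rw [hF v k, map_neg, hfE0, ih0, ih1, map_add, map_smul, map_smul, hF' vp k]
      rcases k with _ | k
      · simp only [Nat.cast_zero, zero_mul, zero_smul, add_zero, zero_add, Nat.cast_one, Nat.sub_self, pow_zero, Module.End.one_apply]
        module
      · rw [Nat.add_sub_cancel, hF' vm k, Nat.add_sub_cancel]
        push_cast
        module
    · rw [hF v k, map_neg, hfE1, ih1, map_add, map_smul, map_smul, hF' vp (k + 1), hF' vm k]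
      module

/-! ## §2 The `𝔭⁻`-action in normal form -/

/-- **KOVAČEVIĆ'S THEOREM 1, `𝔭⁻` HALF**: with `v′₊` primitive of weight `w + δ₂ − δ₁` (type `(n+1, m−3)`) through which every primitive vector of that weight
factors, and `v′₋` for the weight `w + δ₂ − δ₀` (type `(n−1, m−3)`), there are `B, D` with `F₁ u^{k+1} = (n−k)B u′₊^{k+1} − kD u′₋^{k}`,
`F₀ u^{k+1} = B u′₊^{k+2} + D u′₋^{k+1}`. [cite: Kovacevic2021, §3 Thm 1] [cite: BorelWallach2000, II §4.1] -/
theorem pMinus_normalForm {w : Fin 2 ⊕ Fin 1 → ℤ} {n : ℕ} (hn : (n : ℤ) = w (Sum.inl 0) - w (Sum.inl 1) + 1) (hn1 : 1 ≤ n)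
    {v vp vm : V} (hv : ∀ i, upqLieC ρ𝔤 (Matrix.single i i (1 : ℂ)) v = (w i : ℂ) • v) (hev : u21e ρ𝔤 v = 0)
    (hvp : ∀ i, upqLieC ρ𝔤 (Matrix.single i i (1 : ℂ)) vp = ((w + Pi.single (Sum.inr 0) 1 - Pi.single (Sum.inl 1) 1 : Fin 2 ⊕ Fin 1 → ℤ) i : ℂ) • vp)
    (hevp : u21e ρ𝔤 vp = 0)
    (huniqp : ∀ y : V, (∀ i, upqLieC ρ𝔤 (Matrix.single i i (1 : ℂ)) y = ((w + Pi.single (Sum.inr 0) 1 - Pi.single (Sum.inl 1) 1 : Fin 2 ⊕ Fin 1 → ℤ) i : ℂ) • y) →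
      u21e ρ𝔤 y = 0 → ∃ c : ℂ, y = c • vp)
    (huniqm : ∀ y : V, (∀ i, upqLieC ρ𝔤 (Matrix.single i i (1 : ℂ)) y = ((w + Pi.single (Sum.inr 0) 1 - Pi.single (Sum.inl 0) 1 : Fin 2 ⊕ Fin 1 → ℤ) i : ℂ) • y) →
      u21e ρ𝔤 y = 0 → ∃ c : ℂ, y = c • vm) :
    ∃ B D : ℂ, ∀ k : ℕ,
      u21F ρ𝔤 1 (((-u21f ρ𝔤) ^ k) v) = (((n : ℂ) - k) * B) • ((-u21f ρ𝔤) ^ k) vp - ((k : ℂ) * D) • ((-u21f ρ𝔤) ^ (k - 1)) vm ∧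
      u21F ρ𝔤 0 (((-u21f ρ𝔤) ^ k) v) = B • ((-u21f ρ𝔤) ^ (k + 1)) vp + D • ((-u21f ρ𝔤) ^ k) vm := by
  -- abbreviations of the bracket table (★ `U21RootMonomials` §1), applied to vectors
  have heF1 : ∀ x : V, u21e ρ𝔤 (u21F ρ𝔤 1 x) = u21F ρ𝔤 1 (u21e ρ𝔤 x) := fun x => by
    simpa only [Module.End.mul_apply] using LinearMap.congr_fun (u21e_mul_u21F_one ρ𝔤) x
  have heF0 : ∀ x : V, u21e ρ𝔤 (u21F ρ𝔤 0 x) = u21F ρ𝔤 0 (u21e ρ𝔤 x) - u21F ρ𝔤 1 x := fun x => by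
    simpa only [Module.End.mul_apply, LinearMap.sub_apply] using LinearMap.congr_fun (u21e_mul_u21F_zero ρ𝔤) x
  have hfF0 : ∀ x : V, u21F ρ𝔤 0 (u21f ρ𝔤 x) = u21f ρ𝔤 (u21F ρ𝔤 0 x) := fun x => by
    simpa only [Module.End.mul_apply] using (LinearMap.congr_fun (u21f_mul_u21F_zero ρ𝔤) x).symm
  have hfF1 : ∀ x : V, u21F ρ𝔤 1 (u21f ρ𝔤 x) = u21f ρ𝔤 (u21F ρ𝔤 1 x) + u21F ρ𝔤 0 x := fun x => by
    have := LinearMap.congr_fun (u21f_mul_u21F_one ρ𝔤) x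
    simp only [Module.End.mul_apply, LinearMap.sub_apply] at this
    rw [this]; abel
  have hef : ∀ x : V, u21e ρ𝔤 (u21f ρ𝔤 x) = u21f ρ𝔤 (u21e ρ𝔤 x) + u21h ρ𝔤 x := fun x => by
    have := LinearMap.congr_fun (u21e_mul_u21f_sub ρ𝔤) x
    simp only [Module.End.mul_apply, LinearMap.sub_apply] at this
    rw [← this]; abel
  have hF : ∀ (x : V) (j : ℕ), ((-u21f ρ𝔤) ^ (j + 1)) x = -(u21f ρ𝔤 (((-u21f ρ𝔤) ^ j) x)) := fun x j => by
    rw [pow_succ', Module.End.mul_apply, LinearMap.neg_apply]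
  have hF' : ∀ (x : V) (j : ℕ), u21f ρ𝔤 (((-u21f ρ𝔤) ^ j) x) = -(((-u21f ρ𝔤) ^ (j + 1)) x) := fun x j => by
    rw [hF, neg_neg]
  -- `h vp = n vp`
  have hn0 : (n : ℂ) ≠ 0 := by exact_mod_cast (show n ≠ 0 by omega)
  have hhvp : u21h ρ𝔤 vp = (n : ℂ) • vp := by
    rw [u21h_eq_sub, LinearMap.sub_apply, hvp, hvp, ← sub_smul]
    congr 1
    have : ((n : ℤ) : ℂ) = (n : ℂ) := by norm_cast
    rw [← this, hn]
    push_cast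
    simp only [Pi.add_apply, Pi.sub_apply, Pi.single_apply]
    simp
    ring
  -- step 1: `F₁ v = b • vp`
  have hwF1 : ∀ i, upqLieC ρ𝔤 (Matrix.single i i (1 : ℂ)) (u21F ρ𝔤 1 v) =
      ((w + Pi.single (Sum.inr 0) 1 - Pi.single (Sum.inl 1) 1 : Fin 2 ⊕ Fin 1 → ℤ) i : ℂ) • u21F ρ𝔤 1 v := fun i => by
    rw [u21F_eq_upqLieC_single]; exact weight_upqLieC_single ρ𝔤 hv _ _ i
  obtain ⟨b, hb⟩ := huniqp _ hwF1 (by rw [heF1, hev, map_zero])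
  set B : ℂ := b / n with hBdef
  have hB : (n : ℂ) * B = b := by rw [hBdef]; field_simp
  -- step 2: `y = F₀ v − B • (−f) vp` is primitive of weight `w + δ₂ − δ₀`
  have hwF0 : ∀ i, upqLieC ρ𝔤 (Matrix.single i i (1 : ℂ)) (u21F ρ𝔤 0 v) =
      ((w + Pi.single (Sum.inr 0) 1 - Pi.single (Sum.inl 0) 1 : Fin 2 ⊕ Fin 1 → ℤ) i : ℂ) • u21F ρ𝔤 0 v := fun i => by
    rw [u21F_eq_upqLieC_single]; exact weight_upqLieC_single ρ𝔤 hv _ _ i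
  have hwfvp : ∀ i, upqLieC ρ𝔤 (Matrix.single i i (1 : ℂ)) (u21f ρ𝔤 vp) =
      ((w + Pi.single (Sum.inr 0) 1 - Pi.single (Sum.inl 0) 1 : Fin 2 ⊕ Fin 1 → ℤ) i : ℂ) • u21f ρ𝔤 vp := fun i => by
    rw [u21f_eq_upqLieC_single, weight_upqLieC_single ρ𝔤 hvp _ _ i]
    congr 1
    simp only [Pi.add_apply, Pi.sub_apply, Pi.single_apply, Int.cast_add, Int.cast_sub, Int.cast_ite, Int.cast_one, Int.cast_zero]
    split_ifs <;> ring
  have hwy : ∀ i, upqLieC ρ𝔤 (Matrix.single i i (1 : ℂ)) (u21F ρ𝔤 0 v - B • ((-u21f ρ𝔤) vp)) =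
      ((w + Pi.single (Sum.inr 0) 1 - Pi.single (Sum.inl 0) 1 : Fin 2 ⊕ Fin 1 → ℤ) i : ℂ) •
        (u21F ρ𝔤 0 v - B • ((-u21f ρ𝔤) vp)) := fun i => by
    rw [LinearMap.neg_apply, map_sub, map_smul, map_neg, hwF0, hwfvp]
    module
  have hey : u21e ρ𝔤 (u21F ρ𝔤 0 v - B • ((-u21f ρ𝔤) vp)) = 0 := by
    rw [LinearMap.neg_apply, map_sub, map_smul, map_neg, heF0, hev, map_zero, zero_sub, hb, hef, hevp, map_zero,
      zero_add, hhvp, smul_neg, smul_smul, mul_comm B, hB, sub_neg_eq_add, neg_add_cancel]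
  obtain ⟨D, hD⟩ := huniqm _ hwy hey
  have hF0v : u21F ρ𝔤 0 v = B • ((-u21f ρ𝔤) ^ (0 + 1)) vp + D • ((-u21f ρ𝔤) ^ 0) vm := by
    rw [zero_add, pow_one, pow_zero, Module.End.one_apply, ← hD]; abel
  -- step 3: induction on `k`
  refine ⟨B, D, fun k => ?_⟩
  induction k with
  | zero =>
    refine ⟨?_, hF0v⟩
    rw [pow_zero, Module.End.one_apply, hb, ← hB]
    simp
  | succ k ih =>
    obtain ⟨ih1, ih0⟩ := ih
    constructor
    · rw [hF v k, map_neg, hfF1, ih1, ih0, map_sub, map_smul, map_smul, hF' vp k]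
      rcases k with _ | k
      · simp only [Nat.cast_zero, zero_mul, zero_smul, sub_zero, zero_add, Nat.cast_one, Nat.sub_self, pow_zero, Module.End.one_apply]
        module
      · rw [Nat.add_sub_cancel, hF' vm k, Nat.add_sub_cancel]
        push_cast
        module
    · rw [hF v k, map_neg, hfF0, ih0, map_add, map_smul, map_smul, hF' vp (k + 1), hF' vm k]
      module

end Summit.HodgeConjecture.HodgeConjecture.Cruxes.H413.K2E1bU21PActionNormalForm

end
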